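import Mathlib.Data.Real.Basic
import Mathlib.Data.ZMod.ValMinAbs
import Literature.MathematicalPhysics.QuantumFieldTheory.BalabanImbrieJaffe1984to88.BIJ85TorusTentCutoff
import Mathlib.Tactic
import Literature.Probability.LatticeModels.LatticeGraph
import Summits.QuantumFields.YangMills.Theorems.BalabanUVNodesN07PointFeasibilityEnergyIdentity
import HarnessLib

/-!
# DAG node N07 — C^{1,1} PRODUCT BOX CUT-OFFS ON THE TORUS `(ℤ∕N)^d` with controlled FIRST AND SECOND differences
# (the geometric input of the interior plate-energy estimate for discrete biharmonic functions)

Width seat `pub-ymgap-dag-n07-w7` (g6), count-neutral helper (`--supports … --as helper`); companion of this seat's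
`…Theorems.BalabanUVNodesN07PlateCaccioppoliBiharmonic` (p639356: `biharmonic_plate_step` takes its cut-offs as hypotheses with
`|∂χ| ≤ δ`, `|∂∂χ| ≤ δ²`) on g3's calculus (`fd` on `TorusSite d N = Fin d → ZMod N`).

WHAT.  For a centre `z`, a radius `R` and a width `w` (`1 ≤ w ≤ R`, `2(R + w + 3) ≤ N`):
★★ `exists_torusBoxCutoff` — a function `χ : TorusSite d N → [0,1]` with `χ = 1` on the box `{x | ∀ i, |x_i − z_i| ≤ R − w + 1}`,
`χ = 0` off the box of radius `R + w − 1`, `|∂ᵢχ| ≤ 1∕w` and `|∂ⱼ∂ᵢχ| ≤ 2∕w²` for all `i, j` (here `|x_i − z_i|` is the torus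
distance `|valMinAbs(x_i − z_i)|`).  Construction: the product over coordinates of the AVERAGED RAMP
`g(k) = w⁻¹Σ_{s<w} clamp((R + w − k − s)∕w)` of the coordinate distance — averaging a `1∕w`-Lipschitz ramp over a window of `w`
steps makes the SECOND difference telescope to `≤ 2∕w²` (§1), the coordinate distance moves by `±1` per lattice step and by
exactly `±1` away from the centre and the antipode (§2, `ZMod.valMinAbs_spec`), and products of `[0,1]`-valued one-coordinate
factors inherit the bounds (§3).
* §1 `abs_clamp_sub_clamp_le`, the ramp and the averaged ramp (hypothesis-form letters `hr`, `hg`;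
  no definition is introduced): `ramp_eq_one`, `ramp_eq_zero`, `abs_ramp_succ_sub_le`, `avgRamp_succ_sub`, ★ `abs_avgRamp_succ_sub_le`,
  ★ `abs_avgRamp_second_le`, `avgRamp_eq_one`, `avgRamp_eq_zero`, `avgRamp_mem`;
* §2 the torus coordinate distance: the one-step bounds are the tree's `BIJ85TorusTentCutoff.natAbs_valMinAbs_succ_le` ∕
  `natAbs_valMinAbs_le_succ` (BY NAME); ★ `valMinAbs_add_natCast_eq` (exact steps away from the antipode);
* §3 ★ `coordCutoff_bounds` (one coordinate), ★★ `exists_torusBoxCutoff`.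
The tree's neighbours: `BIJ85TorusTentCutoff` (product TENT cut-off on `Site P j`: first differences `≤ 1∕r`, second differences
`≤ 2∕r` concentrated on two kink slabs — here the averaged ramp spreads them to `≤ 2∕w²` POINTWISE, which the plate estimate needs;
its `ZMod` step lemmas are reused BY NAME), `B4Eq19LatticeCaccioppoli.exists_cutoff` (`ℤᵈ`), `B9Ineq346SecondOrderTorusCutoff` (`boxDom`).

HONEST SCOPE.  Elementary real ∕ modular arithmetic; asserts NOTHING about [B11]∕[B6]∕[3]; the iteration that turns
`biharmonic_plate_step` + these cut-offs into `Σ_{B_ρ}(Δh)² ≤ C(d)(r−ρ)⁻⁴Σ_{B_r}h²` is the sequel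
`…N07BiharmonicInteriorEstimate`; (P)_D for Bałaban's `d = 4` geometries OPEN; `hker` at the record, stub 1, K0⁷ ∕ K1⁹ NOT closed;
N07 not discharged; nothing continuum ∕ OS ∕ mass gap.  Context only: M. Giaquinta (1983) Ch. III §2 [Giaquinta1984].

FILE SPLIT (400-line cap): this CORE file holds §1 (clamp ∕ ramp ∕ averaged ramp) and §2 (torus coordinate distance);
the sequel `…N07TorusBoxCutoff` holds §3–§5 (one-coordinate cut-off, product, ★★ `exists_torusBoxCutoff`).
-/

set_option autoImplicit false

noncomputable section

open Finset

namespace Summit.QuantumFields.YangMills.Theorems.N07TorusBoxCutoff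

open Literature.Probability.LatticeModels (TorusSite)
open Summit.QuantumFields.YangMills.Theorems.N07PointFeasibilityEnergyIdentity (fd)

/-! ## §1  The clamp, the ramp and the averaged ramp -/

/-- The clamp `a ↦ min 1 (max 0 a)` is 1-Lipschitz. [folklore] -/
theorem abs_clamp_sub_clamp_le (a b : ℝ) : |min 1 (max 0 a) - min 1 (max 0 b)| ≤ |a - b| := by
  have h1 : |max 0 a - max 0 b| ≤ |a - b| := by
    have := abs_max_sub_max_le_max (0 : ℝ) a 0 b
    simpa using this
  have h2 : |min 1 (max 0 a) - min 1 (max 0 b)| ≤ |max 0 a - max 0 b| := by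
    have := abs_min_sub_min_le_max (1 : ℝ) (max 0 a) 1 (max 0 b)
    simpa using this
  exact h2.trans h1

section Ramp

variable {R w : ℕ}

/-- The ramp is `1` up to `R`. [folklore] -/
theorem ramp_eq_one (r : ℕ → ℝ) (hr : r = fun m : ℕ => min 1 (max 0 (((R : ℝ) + w - m) / w))) (hw : 1 ≤ w) {m : ℕ} (hm : m ≤ R) : r m = 1 := by
  subst hr
  have hw0 : (0 : ℝ) < w := by exact_mod_cast hw
  have h1 : (1 : ℝ) ≤ ((R : ℝ) + w - m) / w := by
    rw [le_div_iff₀ hw0]; have : (m : ℝ) ≤ R := by exact_mod_cast hm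
    linarith
  show min 1 (max 0 (((R : ℝ) + w - m) / w)) = 1
  rw [min_eq_left (le_trans h1 (le_max_right _ _))]

/-- The ramp is `0` from `R + w` on. [folklore] -/
theorem ramp_eq_zero (r : ℕ → ℝ) (hr : r = fun m : ℕ => min 1 (max 0 (((R : ℝ) + w - m) / w))) (hw : 1 ≤ w) {m : ℕ} (hm : R + w ≤ m) : r m = 0 := by
  subst hr
  have hw0 : (0 : ℝ) < w := by exact_mod_cast hw
  have h1 : ((R : ℝ) + w - m) / w ≤ 0 := by
    rw [div_le_iff₀ hw0]; have : ((R : ℝ) + w) ≤ m := by exact_mod_cast hm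
    linarith
  show min 1 (max 0 (((R : ℝ) + w - m) / w)) = 0
  rw [max_eq_left h1, min_eq_right zero_le_one]

/-- `0 ≤ ramp ≤ 1`. [folklore] -/
theorem ramp_mem (r : ℕ → ℝ) (hr : r = fun m : ℕ => min 1 (max 0 (((R : ℝ) + w - m) / w))) (m : ℕ) : 0 ≤ r m ∧ r m ≤ 1 := by
  subst hr; exact ⟨le_min zero_le_one (le_max_left _ _), min_le_left _ _⟩

/-- The ramp is `1∕w`-Lipschitz. [folklore] -/
theorem abs_ramp_succ_sub_le (r : ℕ → ℝ) (hr : r = fun m : ℕ => min 1 (max 0 (((R : ℝ) + w - m) / w))) (hw : 1 ≤ w) (m : ℕ) : |r (m + 1) - r m| ≤ 1 / w := by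
  subst hr
  have hw0 : (0 : ℝ) < w := by exact_mod_cast hw
  refine (abs_clamp_sub_clamp_le _ _).trans (le_of_eq ?_)
  rw [show ((R : ℝ) + w - ((m + 1 : ℕ) : ℝ)) / w - ((R : ℝ) + w - m) / w = -(1 / w) by push_cast; field_simp; ring]
  rw [abs_neg, abs_of_pos (by positivity)]

/-- Any two values of the ramp differ by at most `1`. [folklore] -/
theorem abs_ramp_sub_le_one (r : ℕ → ℝ) (hr : r = fun m : ℕ => min 1 (max 0 (((R : ℝ) + w - m) / w))) (m m' : ℕ) : |r m - r m'| ≤ 1 := by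
  have h1 := ramp_mem r hr m
  have h2 := ramp_mem r hr m'
  rw [abs_le]; constructor <;> linarith [h1.1, h1.2, h2.1, h2.2]

/-- `0 ≤ g ≤ 1`. [folklore] -/
theorem avgRamp_mem (r : ℕ → ℝ) (hr : r = fun m : ℕ => min 1 (max 0 (((R : ℝ) + w - m) / w)))
    (g : ℕ → ℝ) (hg : g = fun k : ℕ => (1 / (w : ℝ)) * ∑ s ∈ Finset.range w, r (k + s)) (hw : 1 ≤ w) (k : ℕ) : 0 ≤ g k ∧ g k ≤ 1 := by
  subst hg
  have hw0 : (0 : ℝ) < w := by exact_mod_cast hw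
  constructor
  · exact mul_nonneg (by positivity) (Finset.sum_nonneg (fun s _ => (ramp_mem r hr _).1))
  · have : ∑ s ∈ Finset.range w, r (k + s) ≤ ∑ _s ∈ Finset.range w, (1 : ℝ) :=
      Finset.sum_le_sum (fun s _ => (ramp_mem r hr _).2)
    rw [Finset.sum_const, Finset.card_range, nsmul_eq_mul, mul_one] at this
    calc (1 / (w : ℝ)) * ∑ s ∈ Finset.range w, r (k + s) ≤ (1 / (w : ℝ)) * w :=
        mul_le_mul_of_nonneg_left this (by positivity)
      _ = 1 := by field_simp

/-- `g = 1` on `k + w ≤ R + 1`. [folklore] -/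
theorem avgRamp_eq_one (r : ℕ → ℝ) (hr : r = fun m : ℕ => min 1 (max 0 (((R : ℝ) + w - m) / w)))
    (g : ℕ → ℝ) (hg : g = fun k : ℕ => (1 / (w : ℝ)) * ∑ s ∈ Finset.range w, r (k + s)) (hw : 1 ≤ w) {k : ℕ} (hk : k + w ≤ R + 1) : g k = 1 := by
  subst hg
  have hw0 : (0 : ℝ) < w := by exact_mod_cast hw
  have : ∑ s ∈ Finset.range w, r (k + s) = ∑ _s ∈ Finset.range w, (1 : ℝ) :=
    Finset.sum_congr rfl (fun s hs => by
      rw [Finset.mem_range] at hs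
      exact ramp_eq_one r hr hw (by omega))
  show (1 / (w : ℝ)) * ∑ s ∈ Finset.range w, r (k + s) = 1
  rw [this, Finset.sum_const, Finset.card_range, nsmul_eq_mul, mul_one]; field_simp

/-- `g = 0` from `R + w` on. [folklore] -/
theorem avgRamp_eq_zero (r : ℕ → ℝ) (hr : r = fun m : ℕ => min 1 (max 0 (((R : ℝ) + w - m) / w)))
    (g : ℕ → ℝ) (hg : g = fun k : ℕ => (1 / (w : ℝ)) * ∑ s ∈ Finset.range w, r (k + s)) (hw : 1 ≤ w) {k : ℕ} (hk : R + w ≤ k) : g k = 0 := by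
  subst hg
  have : ∑ s ∈ Finset.range w, r (k + s) = 0 :=
    Finset.sum_eq_zero (fun s _ => ramp_eq_zero r hr hw (by omega))
  show (1 / (w : ℝ)) * ∑ s ∈ Finset.range w, r (k + s) = 0
  rw [this, mul_zero]

/-- Telescoping: `g(k+1) − g(k) = w⁻¹·(r(k + w) − r(k))`. [folklore] -/
theorem avgRamp_succ_sub (r : ℕ → ℝ)
    (g : ℕ → ℝ) (hg : g = fun k : ℕ => (1 / (w : ℝ)) * ∑ s ∈ Finset.range w, r (k + s)) (k : ℕ) : g (k + 1) - g k = (1 / (w : ℝ)) * (r (k + w) - r k) := by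
  subst hg
  show (1 / (w : ℝ)) * ∑ s ∈ Finset.range w, r (k + 1 + s) - (1 / (w : ℝ)) * ∑ s ∈ Finset.range w, r (k + s) = _
  rw [← mul_sub]
  congr 1
  have h1 : ∑ s ∈ Finset.range (w + 1), r (k + s) = ∑ s ∈ Finset.range w, r (k + (s + 1)) + r (k + 0) :=
    Finset.sum_range_succ' (fun s => r (k + s)) w
  have h2 : ∑ s ∈ Finset.range (w + 1), r (k + s) = ∑ s ∈ Finset.range w, r (k + s) + r (k + w) :=
    Finset.sum_range_succ (fun s => r (k + s)) w
  have h3 : ∑ s ∈ Finset.range w, r (k + 1 + s) = ∑ s ∈ Finset.range w, r (k + (s + 1)) :=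
    Finset.sum_congr rfl (fun s _ => by rw [show k + 1 + s = k + (s + 1) by omega])
  rw [h3, add_zero] at *
  linarith

/-- ★ The averaged ramp is `1∕w`-Lipschitz. [folklore] -/
theorem abs_avgRamp_succ_sub_le (r : ℕ → ℝ) (hr : r = fun m : ℕ => min 1 (max 0 (((R : ℝ) + w - m) / w)))
    (g : ℕ → ℝ) (hg : g = fun k : ℕ => (1 / (w : ℝ)) * ∑ s ∈ Finset.range w, r (k + s)) (hw : 1 ≤ w) (k : ℕ) : |g (k + 1) - g k| ≤ 1 / w := by
  have hw0 : (0 : ℝ) < w := by exact_mod_cast hw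
  rw [avgRamp_succ_sub r g hg k, abs_mul, abs_of_pos (by positivity : (0 : ℝ) < 1 / w)]
  calc 1 / (w : ℝ) * |r (k + w) - r k| ≤ 1 / (w : ℝ) * 1 :=
      mul_le_mul_of_nonneg_left (abs_ramp_sub_le_one r hr _ _) (by positivity)
    _ = 1 / w := mul_one _

/-- ★ **The SECOND difference of the averaged ramp is at most `2∕w²`** (the two telescoped ramp differences are each
`≤ 1∕w`). [folklore] -/
theorem abs_avgRamp_second_le (r : ℕ → ℝ) (hr : r = fun m : ℕ => min 1 (max 0 (((R : ℝ) + w - m) / w)))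
    (g : ℕ → ℝ) (hg : g = fun k : ℕ => (1 / (w : ℝ)) * ∑ s ∈ Finset.range w, r (k + s)) (hw : 1 ≤ w) (k : ℕ) :
    |g (k + 2) - 2 * g (k + 1) + g k| ≤ 2 / (w : ℝ) ^ 2 := by
  have hw0 : (0 : ℝ) < w := by exact_mod_cast hw
  have e : g (k + 2) - 2 * g (k + 1) + g k = (g (k + 1 + 1) - g (k + 1)) - (g (k + 1) - g k) := by ring
  rw [e, avgRamp_succ_sub r g hg (k + 1), avgRamp_succ_sub r g hg k, ← mul_sub]
  rw [show r (k + 1 + w) - r (k + 1) - (r (k + w) - r k) = (r (k + w + 1) - r (k + w)) - (r (k + 1) - r k) by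
    rw [show k + 1 + w = k + w + 1 by omega]; ring]
  rw [abs_mul, abs_of_pos (by positivity : (0 : ℝ) < 1 / w)]
  have h1 := abs_ramp_succ_sub_le r hr hw (k + w)
  have h2 := abs_ramp_succ_sub_le r hr hw k
  have h3 : |r (k + w + 1) - r (k + w) - (r (k + 1) - r k)| ≤ 1 / w + 1 / w :=
    (abs_sub _ _).trans (add_le_add h1 h2)
  calc 1 / (w : ℝ) * |r (k + w + 1) - r (k + w) - (r (k + 1) - r k)| ≤ 1 / (w : ℝ) * (1 / w + 1 / w) :=
      mul_le_mul_of_nonneg_left h3 (by positivity)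
    _ = 2 / (w : ℝ) ^ 2 := by field_simp; ring

end Ramp

/-! ## §2  The torus coordinate distance `|valMinAbs(v − c)|` -/

section Coord

variable {N : ℕ} [NeZero N]

/-! One lattice step moves the coordinate distance `|valMinAbs(·)|` by at most one: the tree's
`BIJ85TorusTentCutoff.natAbs_valMinAbs_succ_le` ∕ `natAbs_valMinAbs_le_succ` (imported, used BY NAME below and in the sequel). -/

/-- ★ **Exact steps away from the antipode**: if `t = valMinAbs u` and `2(|t| + m) ≤ N` for a natural `m`, then
`valMinAbs (u + m) = t + m`. [folklore] -/
theorem valMinAbs_add_natCast_eq (u : ZMod N) (m : ℕ) (hm : 2 * (u.valMinAbs.natAbs + m) ≤ N) :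
    (u + (m : ZMod N)).valMinAbs = u.valMinAbs + m := by
  rw [ZMod.valMinAbs_spec]
  have hmem := u.valMinAbs_mem_Ioc
  refine ⟨?_, ?_, ?_⟩
  · push_cast; simp
  · have h1 := hmem.1
    have : (0 : ℤ) ≤ m := Int.natCast_nonneg m
    linarith
  · have habs : (u.valMinAbs : ℤ) ≤ u.valMinAbs.natAbs := Int.le_natAbs
    have hm' : (2 : ℤ) * (u.valMinAbs.natAbs + m) ≤ N := by exact_mod_cast hm
    linarith

end Coord


end Summit.QuantumFields.YangMills.Theorems.N07TorusBoxCutoff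

end
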